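import Literature.NumberTheory.DiophantineApproximation.PolylogShiftLinearIndependence
import Literature.NumberTheory.DiophantineApproximation.PolylogShiftDivisorBridge
import HarnessLib

/-!
# Linear independence of `1, Li_s(1/N), Li_s(−1/N^{2^i})` (`i < h`, `s ≤ w`) over `ℚ` for `log N ≥ 4^{h+1}(w+1)³`

Topic `Literature/NumberTheory/DiophantineApproximation`. The case `m = 2^h` of the distinct-shifts theorem
`one_lerchShift_linearIndependent` (`PolylogShiftLinearIndependence.lean`) read through the divisor bridge
`PolylogShiftDivisorBridge.lean`: for all `h ≥ 1`, `w ≥ 1` and every integer `N` with `log N ≥ 4^{h+1}(w+1)³`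
(so that `log N^{2^h} ≥ 4 (2^h)³ (w+1)³`) the `(h+1)w + 1` real numbers

  `1`,  `Li_s(1/N)`,  `Li_s(−1/N^{2^i})`   (`0 ≤ i < h`, `1 ≤ s ≤ w`)

are linearly independent over `ℚ` (`one_polylog_tower_linearIndependent`). These are exactly the independent values
carried by the DUPLICATION TOWER of height `h` of the Kontsevich–Zagier box sectors — the levels `±N^{2^i}` (`i < h`)
and `N^{2^h}`, the remaining values `Li_s(N^{−2^{i+1}}) = 2^{s−1}(Li_s(N^{−2^i}) + Li_s(−N^{−2^i}))` being dependent
through the duplication formula; `h = 1` is the two-point theorem of `PolylogTwoPointsLinearIndependence.lean` (with a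
worse constant), `h = 2` is `PolylogShiftFourPointsLinearIndependence.lean`.

## Proof

With `m = 2^h`, `y = 1/N^m` and `Φ_{s,r} = Φ_{s,r}(y)` (`r ≤ m`), the bridge gives
`Li_s(1/N) = ∑_r N^{m−r} Φ_{s,r}` and `Li_s(−1/N^{2^i}) = ∑_{2^i ∣ r} (−1)^{r/2^i} 2^{is} N^{m−r} Φ_{s,r}`, so a relation
`a + ∑_s b_s Li_s(1/N) + ∑_{s,i} c_{s,i} Li_s(−1/N^{2^i}) = 0` is a relation among `1` and the `Φ_{s,r}` with the
coefficients `B_{s,r} = N^{m−r}(b_s + ∑_{2^i ∣ r} (−1)^{r/2^i} 2^{is} c_{s,i})`, all of which vanish by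
`one_lerchShift_linearIndependent`. At `r = 2^i` (`i ≤ h`) the divisors are the `2^{i'}`, `i' ≤ i`, with `r/2^{i'}`
even for `i' < i` and `= 1` for `i' = i`: `P_i := b_s + ∑_{i' < i} 2^{i's} c_{s,i'}` equals `Q_i := [i < h] 2^{is} c_{s,i}`;
since `P_{i+1} = P_i + Q_i = 2P_i` and `P_h = Q_h = 0`, downward induction gives `P_i = 0` for all `i ≤ h`, whence
`c_{s,i} = 0` and `b_s = P_0 = 0`; finally `a = 0`.

References: S. David, N. Hirata-Kohno, M. Kawashima, Moscow J. Comb. Number Th. 9 (2020), Thm 2.1, and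
*Linear independence criteria for generalized polylogarithms with distinct shifts*, arXiv:2010.09167. Crude threshold,
no optimality. -- TODO(general form): algebraic points, all roots of unity `ζ` (complex levels), the thresholds of the papers.
-/

noncomputable section

open Finset

namespace Literature.NumberTheory.DiophantineApproximation

namespace ShiftPade

/-- Casting an `if` from `ℚ` to `ℝ`. [folklore] -/
theorem ratCast_ite (P : Prop) [Decidable P] (x y : ℚ) :
    ((if P then x else y : ℚ) : ℝ) = if P then (x : ℝ) else (y : ℝ) := by
  split_ifs <;> rfl

/-- The divisibility pattern of the powers of two: as a function of `i'`,
`[2^{i'} ∣ 2^i] (−1)^{2^i/2^{i'}} X = [i' < i] X − [i' = i] X` (the quotient `2^{i−i'}` is even for `i' < i`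
and `1` for `i' = i`). [folklore] -/
theorem ite_dvd_two_pow (i' i : ℕ) (X : ℚ) :
    (if 2 ^ i' ∣ 2 ^ i then (-1 : ℚ) ^ (2 ^ i / 2 ^ i') * X else 0) =
      (if i' < i then X else 0) - (if i' = i then X else 0) := by
  rcases lt_trichotomy i' i with hlt | heq | hgt
  · have hdvd : 2 ^ i' ∣ 2 ^ i := pow_dvd_pow 2 hlt.le
    have hq : 2 ^ i / 2 ^ i' = 2 ^ (i - i') := Nat.pow_div hlt.le (by norm_num)
    have heven : Even (2 ^ (i - i')) := (Nat.even_pow).2 ⟨even_two, Nat.sub_ne_zero_of_lt hlt⟩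
    rw [if_pos hdvd, hq, heven.neg_one_pow, one_mul, if_pos hlt, if_neg (ne_of_lt hlt), sub_zero]
  · subst heq
    rw [if_pos dvd_rfl, Nat.div_self (Nat.two_pow_pos i'), pow_one, if_neg (lt_irrefl _), if_pos rfl,
      zero_sub, neg_one_mul]
  · have hndvd : ¬ 2 ^ i' ∣ 2 ^ i := by
      rw [Nat.pow_dvd_pow_iff_le_right (by norm_num)]
      omega
    rw [if_neg hndvd, if_neg (by omega : ¬ i' < i), if_neg (by omega : i' ≠ i), sub_zero]

/-- The partial sums `P_i = ∑_{i' < i} f(i')` over `Fin h` satisfy `P_{i+1} = P_i + [i < h] f(i)`: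
`∑_{i'} [i' < i+1] f = ∑_{i'} [i' < i] f + ∑_{i'} [i' = i] f`. [folklore] -/
theorem sum_ite_lt_succ {h : ℕ} (f : Fin h → ℚ) (i : ℕ) :
    (∑ i' : Fin h, if (i' : ℕ) < i + 1 then f i' else 0) =
      (∑ i' : Fin h, if (i' : ℕ) < i then f i' else 0) + ∑ i' : Fin h, if (i' : ℕ) = i then f i' else 0 := by
  rw [← sum_add_distrib]
  refine sum_congr rfl fun i' _ => ?_
  rcases lt_trichotomy (i' : ℕ) i with hlt | heq | hgt
  · rw [if_pos (by omega), if_pos hlt, if_neg (by omega), add_zero]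
  · rw [if_pos (by omega), if_neg (by omega), if_pos heq, zero_add]
  · rw [if_neg (by omega), if_neg (by omega), if_neg (by omega), add_zero]

/-- The diagonal sums over `Fin h`: `∑_{i'} [i' = i] f(i') = f(i)` for `i < h`. [folklore] -/
theorem sum_ite_eq_of_lt {h : ℕ} (f : Fin h → ℚ) {i : ℕ} (hi : i < h) :
    (∑ i' : Fin h, if (i' : ℕ) = i then f i' else 0) = f ⟨i, hi⟩ := by
  rw [sum_eq_single_of_mem (⟨i, hi⟩ : Fin h) (mem_univ _)]
  · rw [if_pos rfl]
  · intro i' _ hne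
    rw [if_neg]
    intro h'
    exact hne (Fin.ext h')

/-- The diagonal sums over `Fin h` vanish beyond `h`: `∑_{i'} [i' = i] f(i') = 0` for `h ≤ i`. [folklore] -/
theorem sum_ite_eq_of_le {h : ℕ} (f : Fin h → ℚ) {i : ℕ} (hi : h ≤ i) :
    (∑ i' : Fin h, if (i' : ℕ) = i then f i' else 0) = 0 := by
  refine sum_eq_zero fun i' _ => ?_
  rw [if_neg]
  have := i'.isLt
  omega

/-- **The descent**: if `P_i = Q_i` for `i ≤ h`, `P_{i+1} = P_i + Q_i` for all `i` and `Q_h = 0`, then `P_i = 0`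
for all `i ≤ h` (downward induction: `P_h = 0` and `P_{i+1} = 2 P_i`). [folklore] -/
theorem tower_descent (h : ℕ) (P Q : ℕ → ℚ) (hPQ : ∀ i ≤ h, P i = Q i) (hsucc : ∀ i, P (i + 1) = P i + Q i)
    (hQ : Q h = 0) : ∀ i ≤ h, P i = 0 := by
  have key : ∀ k ≤ h, P (h - k) = 0 := by
    intro k
    induction k with
    | zero => intro _; rw [Nat.sub_zero, hPQ h le_rfl, hQ]
    | succ k ih =>
      intro hk
      have h1 : P (h - k) = 0 := ih (by omega)
      have h2 : h - k = (h - (k + 1)) + 1 := by omega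
      rw [h2, hsucc, ← hPQ _ (by omega)] at h1
      linarith
  intro i hi
  have := key (h - i) (by omega)
  rwa [Nat.sub_sub_self hi] at this

/-- **One row of the tower in the `Φ`-basis**: for `N ≥ 2`, every `s` and rational `b, c_i` (`i < h`),
`b Li_s(1/N) + ∑_{i<h} c_i Li_s(−1/N^{2^i}) = ∑_{r<2^h} B_r Φ_{s,r+1}(1/N^{2^h})` with
`B_r = N^{2^h−(r+1)} b + ∑_i c_i [2^i ∣ r+1] (−1)^{(r+1)/2^i} 2^{is} N^{2^h−(r+1)}` (the divisor bridge).
[cite: DavidHirataKohnoKawashima2020, Thm 2.1] -/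
theorem tower_row (h : ℕ) {N : ℕ} (hN : 2 ≤ N) (s : ℕ) (b : ℚ) (c : Fin h → ℚ) :
    (b : ℝ) * DilogPade.polylogSeries s (1 / (N : ℝ)) +
        ∑ i : Fin h, (c i : ℝ) * DilogPade.polylogSeries s (-(1 / (N : ℝ) ^ (2 ^ (i : ℕ)))) =
      ∑ r ∈ range (2 ^ h), (((N : ℚ) ^ (2 ^ h - (r + 1)) * b + ∑ i : Fin h, c i *
          (if 2 ^ (i : ℕ) ∣ r + 1 then (-1) ^ ((r + 1) / 2 ^ (i : ℕ)) * ((2 : ℚ) ^ (i : ℕ)) ^ s *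
            (N : ℚ) ^ (2 ^ h - (r + 1)) else 0) : ℚ) : ℝ) *
        lerchShift (2 ^ h) (r + 1) s (1 / (N : ℝ) ^ (2 ^ h)) := by
  have hrow : ∀ i : Fin h, DilogPade.polylogSeries s (-(1 / (N : ℝ) ^ (2 ^ (i : ℕ)))) =
      ∑ r ∈ range (2 ^ h), (if 2 ^ (i : ℕ) ∣ r + 1 then
          (-1) ^ ((r + 1) / 2 ^ (i : ℕ)) * (((2 ^ (i : ℕ) : ℕ)) : ℝ) ^ s * (N : ℝ) ^ (2 ^ h - (r + 1)) else 0) *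
        lerchShift (2 ^ h) (r + 1) s (1 / (N : ℝ) ^ (2 ^ h)) := by
    intro i
    have hi := i.isLt
    refine polylogSeries_neg_pow_eq_sum_ite s hN (d := 2 ^ (i : ℕ)) (e := 2 ^ (h - 1 - i))
      Nat.one_le_two_pow Nat.one_le_two_pow ?_
    rw [← pow_succ', ← pow_add]
    congr 1
    omega
  rw [polylogSeries_eq_sum_lerchShift s hN (2 ^ h) Nat.one_le_two_pow, mul_sum]
  simp_rw [hrow, mul_sum, ← mul_assoc]
  rw [sum_comm, ← sum_add_distrib]
  refine sum_congr rfl fun r _ => ?_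
  rw [← sum_mul, ← add_mul]
  congr 1
  push_cast [ratCast_ite]
  rw [mul_comm]

end ShiftPade

open ShiftPade

/-- **Linear independence of `1, Li_s(1/N), Li_s(−1/N^{2^i})` (`i < h`, `1 ≤ s ≤ w`) over `ℚ`** for `h, w ≥ 1` and
`log N ≥ 4^{h+1}(w+1)³`: every rational relation
`a + ∑_{j<w} b_j Li_{j+1}(1/N) + ∑_{j<w} ∑_{i<h} c_{j,i} Li_{j+1}(−1/N^{2^i}) = 0` is trivial — the rigidity input of
the duplication tower of height `h` (levels `±N^{2^i}`, `i < h`, and `N^{2^h}`).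
[cite: DavidHirataKohnoKawashima2020, Thm 2.1] -/
theorem one_polylog_tower_linearIndependent (h w : ℕ) (hh : 1 ≤ h) (hw : 1 ≤ w) (N : ℕ)
    (hN : 4 * 4 ^ h * ((w : ℝ) + 1) ^ 3 ≤ Real.log N) (a : ℚ) (b : Fin w → ℚ) (c : Fin w → Fin h → ℚ)
    (hrel : (a : ℝ) + ∑ j : Fin w, (b j : ℝ) * DilogPade.polylogSeries ((j : ℕ) + 1) (1 / (N : ℝ)) +
      ∑ j : Fin w, ∑ i : Fin h, (c j i : ℝ) *
        DilogPade.polylogSeries ((j : ℕ) + 1) (-(1 / (N : ℝ) ^ (2 ^ (i : ℕ)))) = 0) :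
    a = 0 ∧ b = 0 ∧ c = 0 := by
  -- `N ≥ 2`
  have hw1 : (1 : ℝ) ≤ w := by exact_mod_cast hw
  have h4h : (4 : ℝ) ≤ 4 ^ h := by
    calc (4 : ℝ) = 4 ^ 1 := by norm_num
      _ ≤ 4 ^ h := pow_le_pow_right₀ (by norm_num) hh
  have hL : (128 : ℝ) ≤ Real.log N := by
    have h2 : (8 : ℝ) ≤ ((w : ℝ) + 1) ^ 3 := by
      have := pow_le_pow_left₀ (by norm_num : (0 : ℝ) ≤ 2) (by linarith : (2 : ℝ) ≤ (w : ℝ) + 1) 3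
      norm_num at this
      exact this
    have h3 : (4 : ℝ) * 4 * 8 ≤ 4 * 4 ^ h * ((w : ℝ) + 1) ^ 3 :=
      mul_le_mul (mul_le_mul_of_nonneg_left h4h (by norm_num)) h2 (by norm_num) (by positivity)
    linarith
  have hN0 : (N : ℝ) ≠ 0 := by
    intro h0; rw [h0, Real.log_zero] at hL; linarith
  have hNpos : (0 : ℝ) < N := lt_of_le_of_ne (Nat.cast_nonneg N) (Ne.symm hN0)
  have hN2R : (2 : ℝ) ≤ N := by
    have h1 : Real.log N ≤ (N : ℝ) - 1 := Real.log_le_sub_one_of_pos hNpos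
    linarith
  have hN2 : 2 ≤ N := by exact_mod_cast hN2R
  have hNQ : (N : ℚ) ≠ 0 := by exact_mod_cast (show N ≠ 0 by omega)
  -- `m = 2^h`, `M = N^m`, `log M = 2^h log N ≥ 4 m³ (w+1)³`
  have hm2 : 2 ≤ 2 ^ h := by
    calc 2 = 2 ^ 1 := rfl
      _ ≤ 2 ^ h := Nat.pow_le_pow_right (by norm_num) hh
  have hM : 4 * (((2 ^ h : ℕ)) : ℝ) ^ 3 * ((w : ℝ) + 1) ^ 3 ≤ Real.log ((N ^ 2 ^ h : ℕ) : ℝ) := by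
    push_cast
    rw [Real.log_pow]
    have e1 : ((2 : ℝ) ^ h) ^ 2 = 4 ^ h := by
      rw [← pow_mul, mul_comm, pow_mul]; norm_num
    have hpos : (0 : ℝ) ≤ (2 : ℝ) ^ h := by positivity
    have h1 := mul_le_mul_of_nonneg_left hN hpos
    calc 4 * ((2 : ℝ) ^ h) ^ 3 * ((w : ℝ) + 1) ^ 3 = (2 : ℝ) ^ h * (4 * 4 ^ h * ((w : ℝ) + 1) ^ 3) := by
          rw [← e1]; ring
      _ ≤ (2 : ℝ) ^ h * Real.log N := h1
      _ = ((2 ^ h : ℕ) : ℝ) * Real.log N := by push_cast; ring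
  have hcast : (1 / (N : ℝ) ^ (2 ^ h)) = 1 / ((N ^ 2 ^ h : ℕ) : ℝ) := by push_cast; ring
  -- the coefficients in the `Φ`-basis
  set Bn : Fin w → ℕ → ℚ := fun j r => (N : ℚ) ^ (2 ^ h - (r + 1)) * b j + ∑ i : Fin h, c j i *
      (if 2 ^ (i : ℕ) ∣ r + 1 then (-1) ^ ((r + 1) / 2 ^ (i : ℕ)) * ((2 : ℚ) ^ (i : ℕ)) ^ ((j : ℕ) + 1) *
        (N : ℚ) ^ (2 ^ h - (r + 1)) else 0) with hBn
  have h' : (a : ℝ) + ∑ j : Fin w, ∑ r : Fin (2 ^ h), (Bn j r : ℝ) *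
      lerchShift (2 ^ h) ((r : ℕ) + 1) ((j : ℕ) + 1) (1 / ((N ^ 2 ^ h : ℕ) : ℝ)) = 0 := by
    rw [← hrel, ← hcast, add_assoc, ← sum_add_distrib]
    congr 1
    refine sum_congr rfl fun j _ => ?_
    rw [tower_row h hN2 ((j : ℕ) + 1) (b j) (c j)]
    exact Fin.sum_univ_eq_sum_range
      (fun r => (Bn j r : ℝ) * lerchShift (2 ^ h) (r + 1) ((j : ℕ) + 1) (1 / (N : ℝ) ^ (2 ^ h))) (2 ^ h)
  obtain ⟨ha, hBz⟩ := one_lerchShift_linearIndependent (2 ^ h) w hm2 hw (N ^ 2 ^ h) hM a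
    (fun j r => Bn j r) h'
  -- the equations at `r + 1 = 2^i`, `i ≤ h`
  have hPQ : ∀ j : Fin w, ∀ i ≤ h,
      (b j + ∑ i' : Fin h, if (i' : ℕ) < i then ((2 : ℚ) ^ (i' : ℕ)) ^ ((j : ℕ) + 1) * c j i' else 0) =
        ∑ i' : Fin h, if (i' : ℕ) = i then ((2 : ℚ) ^ (i' : ℕ)) ^ ((j : ℕ) + 1) * c j i' else 0 := by
    intro j i hi
    have hlt : 2 ^ i - 1 < 2 ^ h := by
      have h1 : 2 ^ i ≤ 2 ^ h := Nat.pow_le_pow_right (by norm_num) hi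
      have h2 := Nat.one_le_two_pow (n := i)
      omega
    have h0 := congrFun (congrFun hBz j) ⟨2 ^ i - 1, hlt⟩
    simp only [Pi.zero_apply, hBn, Nat.sub_add_cancel Nat.one_le_two_pow] at h0
    have hpow : (N : ℚ) ^ (2 ^ h - 2 ^ i) ≠ 0 := pow_ne_zero _ hNQ
    have h1 : (N : ℚ) ^ (2 ^ h - 2 ^ i) *
        ((b j + ∑ i' : Fin h, if (i' : ℕ) < i then ((2 : ℚ) ^ (i' : ℕ)) ^ ((j : ℕ) + 1) * c j i' else 0) -
          ∑ i' : Fin h, if (i' : ℕ) = i then ((2 : ℚ) ^ (i' : ℕ)) ^ ((j : ℕ) + 1) * c j i' else 0) =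
        (N : ℚ) ^ (2 ^ h - 2 ^ i) * b j + ∑ i' : Fin h, c j i' *
          (if 2 ^ (i' : ℕ) ∣ 2 ^ i then (-1) ^ (2 ^ i / 2 ^ (i' : ℕ)) * ((2 : ℚ) ^ (i' : ℕ)) ^ ((j : ℕ) + 1) *
            (N : ℚ) ^ (2 ^ h - 2 ^ i) else 0) := by
      rw [mul_sub, mul_add, mul_sum, mul_sum, add_sub_assoc, ← sum_sub_distrib]
      congr 1
      refine sum_congr rfl fun i' _ => ?_
      have key := ite_dvd_two_pow (i' : ℕ) i (((2 : ℚ) ^ (i' : ℕ)) ^ ((j : ℕ) + 1) * c j i')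
      rw [← mul_sub, ← key]
      split_ifs <;> ring
    rw [h0] at h1
    rcases mul_eq_zero.1 h1 with h2 | h2
    · exact absurd h2 hpow
    · exact sub_eq_zero.1 h2
  -- the descent, row by row
  have hP0 : ∀ j : Fin w, ∀ i ≤ h,
      (b j + ∑ i' : Fin h, if (i' : ℕ) < i then ((2 : ℚ) ^ (i' : ℕ)) ^ ((j : ℕ) + 1) * c j i' else 0) = 0 := by
    intro j
    refine tower_descent h
      (fun i => b j + ∑ i' : Fin h, if (i' : ℕ) < i then ((2 : ℚ) ^ (i' : ℕ)) ^ ((j : ℕ) + 1) * c j i' else 0)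
      (fun i => ∑ i' : Fin h, if (i' : ℕ) = i then ((2 : ℚ) ^ (i' : ℕ)) ^ ((j : ℕ) + 1) * c j i' else 0)
      (hPQ j) (fun i => ?_) (sum_ite_eq_of_le _ le_rfl)
    rw [sum_ite_lt_succ, add_assoc]
  have hc : ∀ (j : Fin w) (i : Fin h), c j i = 0 := by
    intro j i
    have h1 := hPQ j i i.isLt.le
    rw [hP0 j i i.isLt.le, sum_ite_eq_of_lt _ i.isLt] at h1
    have h2 : ((2 : ℚ) ^ (i : ℕ)) ^ ((j : ℕ) + 1) ≠ 0 := by positivity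
    rcases mul_eq_zero.1 h1.symm with h3 | h3
    · exact absurd h3 h2
    · exact h3
  have hb : ∀ j : Fin w, b j = 0 := by
    intro j
    have h1 := hP0 j 0 (Nat.zero_le h)
    simpa using h1
  refine ⟨ha, funext fun j => hb j, funext fun j => funext fun i => hc j i⟩

end Literature.NumberTheory.DiophantineApproximation
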